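import Literature.AnabelianGeometry.EtaleTheta.ThetaRigidity
import Literature.AnabelianGeometry.EtaleTheta.TorsorSystems
import Mathlib.Topology.Algebra.OpenSubgroup

/-!
# Projective systems of mono-theta environments; discrete and constant-multiple rigidity
# ([EtTh] §2: Prop 2.11 (ii), Cor 2.16, Rmk 2.16.1, Cor 2.18 (iv), Cor 2.19 (ii), (iii))

Mochizuki, *The Étale Theta Function …* [EtTh], Publ. RIMS 45 (2009), §2, PRIMS text pp.44–65
(locators `p.N` = PDF pages; bib key `MochizukiEtTh2009`). `centralizerUnion_cycEnvelope_eq` =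
**Prop 2.11 (ii) PROVED** (temp-slim `Π`, continuous action); `ThetaEnvTower E` = the interface `ThetaEnvData` at all levels
`M ∈ E` with reductions `μ_{M'} ↠ μ_M`; `MTESystem` = projective systems of mono-theta environments
in the normal form "models with twisted transition maps" (any system is term-wise isomorphic to one,
Def 2.13 (ii)); Cor 2.18 (iv) second half; Cor 2.19 (ii); Cor 2.16; Rmk 2.16.1 (iii) PROVED
(`ℤ → lim_{M ∈ E} ℤ/Mℤ` is not onto); Cor 2.19 (iii) first half, functoriality content (tower form; second half in `ThetaBiSystems.lean`; the standard-type rigidity clause = Cor 2.8 (i) in `ThetaRootOrbits.lean`). Typing conventions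
as in `ThetaRigidity.lean` ("functorial algorithm" = invariance).
-/

namespace Literature.AnabelianGeometry.EtaleTheta

universe u

/-! ## Proposition 2.11 (ii) -/

section Prop211

variable {P G μ : Type*} [Group P] [Group G] [CommGroup μ] (aug : P →* G) (χ : G →* MulAut μ)
  [TopologicalSpace P] [IsTopologicalGroup P] [TopologicalSpace μ]

/-- **Proposition 2.11 (ii)** (General Properties of the Cyclotomic Envelope), PROVED: if `Π` is
temp-slim (every open subgroup has trivial centraliser, [SemiAnbd] Ex. 3.10) and the action of `Π`
on `μ_N` is continuous (open kernel; any topology on `μ_N`), then "the kernel of the natural surjection `Π[μ_N] ↠ Π` is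
equal to the union of the centralizers of the open subgroups of `Π[μ_N]`". In particular any
isomorphism of topological groups `Π_α[μ_N] ≃ Π_β[μ_N]` is compatible with the surjections to
`Π_∘` (it preserves this union). [cite: MochizukiEtTh2009, Prop 2.11(ii) p.44] -/
theorem centralizerUnion_cycEnvelope_eq
    (hslim : ∀ U : Subgroup P, IsOpen (U : Set P) → ∀ z : P, (∀ u ∈ U, z * u = u * z) → z = 1)
    (hχ : IsOpen (((χ.comp aug).ker : Subgroup P) : Set P)) :
    centralizerUnion (CycEnvelope aug χ) = (CycEnvelope.proj aug χ).ker := by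
  ext z
  constructor
  · rintro ⟨U, hU, hz⟩
    rw [Subgroup.mem_centralizer_iff] at hz
    -- `U` contains `s^alg(W)` for an open subgroup `W` of `P`
    rw [MonoidHom.mem_ker]
    let W : Subgroup P := U.comap (CycEnvelope.algSection aug χ)
    have hWopen : IsOpen (W : Set P) := by
      apply Subgroup.isOpen_of_mem_nhds (g := 1)
      obtain ⟨V, hV, hVU⟩ := isOpen_induced_iff.mp hU
      have h1 : ((1 : μ), (1 : P)) ∈ V := by
        have : (1 : CycEnvelope aug χ) ∈ (U : Set (CycEnvelope aug χ)) := U.one_mem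
        rw [← hVU] at this
        simpa using this
      obtain ⟨Vμ, hVμ, VP, hVP, hprod⟩ := mem_nhds_prod_iff.mp (hV.mem_nhds h1)
      refine Filter.mem_of_superset hVP fun w hw => ?_
      change SemidirectProduct.inr w ∈ (U : Set (CycEnvelope aug χ))
      have : ((SemidirectProduct.inr w : CycEnvelope aug χ).left,
          (SemidirectProduct.inr w : CycEnvelope aug χ).right) ∈ V :=
        hprod (Set.mk_mem_prod (mem_of_mem_nhds hVμ) hw)
      rw [← hVU]
      exact this
    have : z.right = 1 := hslim W hWopen z.right fun w hw => by
      have := congrArg SemidirectProduct.right (hz _ hw)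
      simpa using this.symm
    exact this
  · intro hz
    rw [MonoidHom.mem_ker] at hz
    change z.right = 1 at hz
    refine ⟨((χ.comp aug).ker).comap (CycEnvelope.proj aug χ),
      (CycEnvelope.continuous_proj aug χ).isOpen_preimage _ hχ, ?_⟩
    rw [Subgroup.mem_centralizer_iff]
    intro u hu
    rw [SetLike.mem_coe, Subgroup.mem_comap, MonoidHom.mem_ker] at hu
    change χ (aug u.right) = 1 at hu
    ext
    · simp [hz, hu, mul_comm]
    · simp [hz]

/-- **Corollary 2.18 (iii)**, first part, DISCHARGED conditionally: for rigidity data with temp-slim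
`Π^tp_Y` the named fact `Cor218_iii_quotient` holds (Prop 2.11 (ii)). [cite: MochizukiEtTh2009, Cor 2.18(iii) p.61] -/
theorem RigidData.cor218_iii_quotient_of_slim {N : ℕ+} {l : ℕ} (R : RigidData.{u} N l)
    (hslim : ∀ U : Subgroup R.PiY, IsOpen (U : Set R.PiY) →
      ∀ z : R.PiY, (∀ u ∈ U, z * u = u * z) → z = 1) :
    R.Cor218_iii_quotient := by
  refine centralizerUnion_cycEnvelope_eq R.augY R.chi hslim ?_
  have h := R.chi_ker_open
  have : (((R.chi.comp R.augY).ker : Subgroup R.PiY) : Set R.PiY) =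
      Subtype.val ⁻¹' (((R.chi.comp R.aug).ker : Subgroup R.PiX) : Set R.PiX) := by
    ext g; simp [MonoidHom.mem_ker]
  rw [this]
  exact h.preimage continuous_subtype_val

end Prop211

/-! ## Towers of theta-environment data (all levels `M ∈ E`) -/

/-- **Interface**: the data of `ThetaEnvData` at every level `M` of a cofinal, totally ordered
`E ⊆ ℕ≥1` containing `1` (Prop 2.15), with the reductions `μ_{M'} ↠ μ_M`, `M ∣ M'` ("`M_{N'}` … induced
by `M`", Def 2.13 (ii); "by letting the integer `N` vary in `E`, we obtain a natural projective
system", Cor 2.19 (ii)); cocycles at the various levels are reductions of one another.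
TODO-merge(abc-iut-L2-t1) as for `ThetaEnvData`. [cite: MochizukiEtTh2009, Cor 2.19(ii) p.64] -/
structure ThetaEnvTower (E : Set ℕ+) : Type (u + 1) where
  /-- `1 ∈ E` -/
  one_mem : (1 : ℕ+) ∈ E
  /-- `E` is cofinal in `(ℕ≥1, ∣)` -/
  cofinal : ∀ n : ℕ+, ∃ M ∈ E, n ∣ M
  /-- `E` is totally ordered by divisibility -/
  total : ∀ M ∈ E, ∀ M' ∈ E, M ∣ M' ∨ M' ∣ M
  -- the fields below without docstrings are those of `ThetaEnvData` (printed sentences there)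
  PiX : Type u
  [grpPiX : Group PiX]
  [topPiX : TopologicalSpace PiX]
  [tgPiX : IsTopologicalGroup PiX]
  G : Type u
  [grpG : Group G]
  aug : PiX →* G
  aug_surjective : Function.Surjective aug
  PiY : Subgroup PiX
  PiY_normal : PiY.Normal
  PiY_open : IsOpen (PiY : Set PiX)
  galYX : PiX ⧸ PiY ≃* Multiplicative ℤ
  PiYdd : Subgroup PiX
  PiYdd_le : PiYdd ≤ PiY
  PiYdd_normal : PiYdd.Normal
  PiYdd_open : IsOpen (PiYdd : Set PiX)
  index_PiYdd : (PiYdd.subgroupOf PiY).index = 2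
  /-- the cyclotomes `μ_M`, `M ∈ E` -/
  mu : E → Type u
  [cgMu : ∀ M, CommGroup (mu M)]
  [topMu : ∀ M, TopologicalSpace (mu M)]
  [discMu : ∀ M, DiscreteTopology (mu M)]
  [finMu : ∀ M, Fintype (mu M)]
  mu_cyclic : ∀ M, IsCyclic (mu M)
  card_mu : ∀ M : E, Fintype.card (mu M) = (M : ℕ+)
  chi : ∀ M, G →* MulAut (mu M)
  chi_ker_open : ∀ M, IsOpen ((((chi M).comp aug).ker : Subgroup PiX) : Set PiX)
  /-- the mod-`M` theta cocycles -/
  thetaCocycles : ∀ M, Set (PiYdd → mu M)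
  thetaCocycles_nonempty : ∀ M, (thetaCocycles M).Nonempty
  isCocycle : ∀ M, ∀ η ∈ thetaCocycles M,
    CycEnvelope.IsEnvCocycle (aug.comp PiYdd.subtype) (chi M) η
  locallyConstant : ∀ M, ∀ η ∈ thetaCocycles M, IsLocallyConstant η
  mul_coboundary_mem : ∀ M, ∀ η ∈ thetaCocycles M, ∀ c : mu M,
    η * CycEnvelope.coboundary (aug.comp PiYdd.subtype) (chi M) c ∈ thetaCocycles M
  /-- the reductions `μ_{M'} ↠ μ_M` for `M ∣ M'` -/
  red : ∀ (M M' : E), ((M : ℕ+) ∣ M') → (mu M' →* mu M)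
  red_surjective : ∀ M M' h, Function.Surjective (red M M' h)
  red_self : ∀ (M : E) (h : (M : ℕ+) ∣ M) a, red M M h a = a
  red_comp : ∀ (M M' M'' : E) (h : (M : ℕ+) ∣ M') (h' : (M' : ℕ+) ∣ M'') a,
    red M M'' (h.trans h') a = red M M' h (red M' M'' h' a)
  red_chi : ∀ M M' h (g : G) a, red M M' h (chi M' g a) = chi M g (red M M' h a)
  /-- the mod-`M` cocycles are the reductions of the mod-`M'` cocycles … -/
  red_cocycle_mem : ∀ M M' h, ∀ η ∈ thetaCocycles M', (red M M' h ∘ η) ∈ thetaCocycles M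
  /-- … all of them -/
  red_cocycle_surj : ∀ M M' h, ∀ η ∈ thetaCocycles M, ∃ η' ∈ thetaCocycles M', red M M' h ∘ η' = η
  /-- the inverse image of `(l·Δ_Θ)` in `Π^tp_X` (as in `RigidData`, p.45) -/
  lDeltaTheta : Subgroup PiX
  /-- "(l·Δ_Θ) ↠ (l·Δ_Θ) ⊗ ℤ/Mℤ ≅ μ_M" at every level (p.46) … -/
  thetaMod : ∀ M, lDeltaTheta →* mu M
  /-- … onto … -/
  thetaMod_surjective : ∀ M, Function.Surjective (thetaMod M)
  /-- … and compatible with the reductions -/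
  red_thetaMod : ∀ M M' h (g : lDeltaTheta), red M M' h (thetaMod M' g) = thetaMod M g

attribute [instance] ThetaEnvTower.grpPiX ThetaEnvTower.topPiX ThetaEnvTower.tgPiX
  ThetaEnvTower.grpG ThetaEnvTower.cgMu ThetaEnvTower.topMu ThetaEnvTower.discMu
  ThetaEnvTower.finMu

namespace ThetaEnvTower

variable {E : Set ℕ+} (T : ThetaEnvTower.{u} E)

/-- The level-`M` data. [cite: MochizukiEtTh2009, Cor 2.19(ii) p.64] -/
abbrev level (M : E) : ThetaEnvData.{u} M :=
  { PiX := T.PiX, G := T.G, aug := T.aug, aug_surjective := T.aug_surjective, PiY := T.PiY,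
    PiY_normal := T.PiY_normal, PiY_open := T.PiY_open, galYX := T.galYX, PiYdd := T.PiYdd,
    PiYdd_le := T.PiYdd_le, PiYdd_normal := T.PiYdd_normal, PiYdd_open := T.PiYdd_open,
    index_PiYdd := T.index_PiYdd, mu := T.mu M, mu_cyclic := T.mu_cyclic M,
    card_mu := T.card_mu M, chi := T.chi M, chi_ker_open := T.chi_ker_open M,
    thetaCocycles := T.thetaCocycles M, thetaCocycles_nonempty := T.thetaCocycles_nonempty M,
    isCocycle := T.isCocycle M, locallyConstant := T.locallyConstant M,
    mul_coboundary_mem := T.mul_coboundary_mem M }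

/-- The reduction `Π^tp_Y[μ_{M'}] → Π^tp_Y[μ_M]` (`M ∣ M'`; identity on `Π^tp_Y`) underlying "`M_{N'}`,
the mod `N'` environment induced by `M`" (Def 2.13 (ii)). [cite: MochizukiEtTh2009, Def 2.13(ii) p.48] -/
def redEnv (M M' : E) (h : (M : ℕ+) ∣ M') : (T.level M').env →* (T.level M).env :=
  SemidirectProduct.map (T.red M M' h) (MonoidHom.id _) (fun g => by
    ext a
    change T.red M M' h (T.chi M' (T.aug (g : T.PiX)) a) = T.chi M (T.aug (g : T.PiX)) (T.red M M' h a)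
    exact T.red_chi M M' h _ a)

/-- "`α'` induces `α` on the mod-`M` reduction" (Cor 2.18 (iv): "a natural homomorphism
`Aut^μ(M) → Aut^μ(M_M)`"), as a relation. [cite: MochizukiEtTh2009, Cor 2.18(iv) p.61] -/
def Reduces {M M' : E} (h : (M : ℕ+) ∣ M') (α' : MulAut (T.level M').env)
    (α : MulAut (T.level M).env) : Prop :=
  ∀ x, T.redEnv M M' h (α' x) = α (T.redEnv M M' h x)

/-- **Corollary 2.18 (iv)**, second half, existence: every automorphism of the model `M_{M'}` induces
one of the model `M_M` (`M ∣ M'`). [cite: MochizukiEtTh2009, Cor 2.18(iv) p.61] -/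
def Cor218_iv_reduction : Prop :=
  ∀ (M M' : E) (h : (M : ℕ+) ∣ M') (η' : T.PiYdd → T.mu M') (hη' : η' ∈ T.thetaCocycles M')
    (α' : ((T.level M').modelMono hη').Iso ((T.level M').modelMono hη')),
    ∃ α : ((T.level M).modelMono (T.red_cocycle_mem M M' h η' hη')).Iso
        ((T.level M).modelMono (T.red_cocycle_mem M M' h η' hη')),
      T.Reduces h α'.e.toMulEquiv α.e.toMulEquiv

/-- **Corollary 2.18 (iv)**, second half, "[hence is a bijection if `N/M` is odd]": for `M ∣ M'`,
`M'/M` odd, `Aut^μ(M_{M'}) → Aut^μ(M_M)` is bijective — lifting up to `μ_M`-conjugacy, and kernel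
trivial modulo `μ_{M'}`-conjugacy. (In general kernel/cokernel compare with those of
`Hom(ℤ/2,ℤ/M') → Hom(ℤ/2,ℤ/M)`.) [cite: MochizukiEtTh2009, Cor 2.18(iv) p.62] -/
def Cor218_iv_bijective_of_odd : Prop :=
  ∀ (M M' : E) (h : (M : ℕ+) ∣ M'), Odd ((M' : ℕ+) / (M : ℕ+) : ℕ) →
    ∀ (η' : T.PiYdd → T.mu M') (hη' : η' ∈ T.thetaCocycles M'),
    let hη := T.red_cocycle_mem M M' h η' hη'
    (∀ α : ((T.level M).modelMono hη).Iso ((T.level M).modelMono hη),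
      ∃ (α' : ((T.level M').modelMono hη').Iso ((T.level M').modelMono hη')) (c : T.mu M),
        T.Reduces h α'.e.toMulEquiv
          (MulAut.conj (CycEnvelope.inMu (T.level M).augY (T.chi M) c) *
            (α.e.toMulEquiv : MulAut (T.level M).env))) ∧
    (∀ (α' : ((T.level M').modelMono hη').Iso ((T.level M').modelMono hη')) (c : T.mu M),
      T.Reduces h α'.e.toMulEquiv (MulAut.conj (CycEnvelope.inMu (T.level M).augY (T.chi M) c)) →
      ∃ c' : T.mu M', α'.e.toMulEquiv =
        MulAut.conj (CycEnvelope.inMu (T.level M').augY (T.chi M') c'))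

/-! ## Projective systems of mono-theta environments (Cor 2.19 (ii)) -/

/-- A **projective system of mono-theta environments** indexed by `E` (Cor 2.19 (ii)), in normal
form: by Def 2.13 (ii) every term is isomorphic to a model, so a system is given by a compatible
family of theta cocycles `η_M` (objects `M_M = modelMono η_M`) and transition morphisms
`γ_{M',M} = a_{M',M} ∘ red_{M',M}` with `a_{M',M}` (the underlying map of) an automorphism of `M_M`,
subject to `γ_{M,M} = id` and `γ_{M'',M} = γ_{M',M} ∘ (γ_{M'',M'})`. The NATURAL system has all
`a = 1`. [cite: MochizukiEtTh2009, Cor 2.19(ii) p.64] -/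
structure MTESystem : Type u where
  /-- the cocycles `η_M` -/
  η : ∀ M : E, T.PiYdd → T.mu M
  /-- membership -/
  mem : ∀ M, η M ∈ T.thetaCocycles M
  /-- compatibility `red ∘ η_{M'} = η_M` -/
  compat : ∀ (M M' : E) (h : (M : ℕ+) ∣ M'), T.red M M' h ∘ η M' = η M
  /-- the twists `a_{M',M} ∈ Aut(M_M)` of the transition maps -/
  a : ∀ M M' : E, ((M : ℕ+) ∣ M') → MulAut (T.level M).env
  /-- each `a_{M',M}` underlies an automorphism of the mono-theta environment `M_M` -/
  isAut : ∀ M M' h, ∃ α : ((T.level M).modelMono (mem M)).Iso ((T.level M).modelMono (mem M)),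
    α.e.toMulEquiv = a M M' h
  /-- `γ_{M,M} = id` -/
  a_self : ∀ (M : E) (h : (M : ℕ+) ∣ M), a M M h = 1
  /-- `γ_{M'',M} = γ_{M',M} ∘ γ_{M'',M'}` -/
  a_comp : ∀ (M M' M'' : E) (h : (M : ℕ+) ∣ M') (h' : (M' : ℕ+) ∣ M'') (x : (T.level M'').env),
    a M M'' (h.trans h') (T.redEnv M M'' (h.trans h') x) =
      a M M' h (T.redEnv M M' h (a M' M'' h' (T.redEnv M' M'' h' x)))

/-- **Corollary 2.19 (ii)** (Discrete Rigidity): any projective system of mono-theta environments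
indexed by `E` is isomorphic to the natural one — there are automorphisms `α_M` of `M_M` with
`γ_{M',M} ∘ α_{M'} = α_M ∘ β_{M',M}` ("[cf. Proposition 2.15, (ii)]").
[cite: MochizukiEtTh2009, Cor 2.19(ii) p.64] -/
def Cor219_ii : Prop :=
  ∀ S : T.MTESystem, ∃ α : ∀ M : E, MulAut (T.level M).env,
    (∀ M, ∃ e : ((T.level M).modelMono (S.mem M)).Iso ((T.level M).modelMono (S.mem M)),
      e.e.toMulEquiv = α M) ∧
    ∀ (M M' : E) (h : (M : ℕ+) ∣ M') (x : (T.level M').env),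
      S.a M M' h (T.redEnv M M' h (α M' x)) = α M (T.redEnv M M' h x)

/-! ### Remark 2.16.1 (pp.55–56): (i)–(ii) mono- vs bi-theta environments (limit torsor over
`lim (l·ℤ/l·ℤ) = 0` vs over `lim (l·ℤ/N·l·ℤ) = l·Ẑ`; "multi-bi-theta environments" do not help) —
commentary; (iii) `R¹lim_{N} {N·l·ℤ} ≅ l·Ẑ/l·ℤ ≠ 0` is typed and PROVED below as the
non-surjectivity of `ℤ → lim_{M ∈ E} ℤ/Mℤ`. -/

/-- **Remark 2.16.1 (iii)** (non-vanishing of `R¹lim {N·l·ℤ}_N ≅ (l·Ẑ)/(l·ℤ)`), PROVED in the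
concrete form: for `E` cofinal there is a compatible family of residues `(x_M)_{M ∈ E}` that is not
the image of any integer. [cite: MochizukiEtTh2009, Rmk 2.16.1(iii) p.56] -/
theorem exists_compatible_family_not_integral (hcof : ∀ n : ℕ+, ∃ M ∈ E, n ∣ M) :
    ∃ x : ∀ M : E, ZMod (M : ℕ+),
      (∀ (M M' : E) (h : (M : ℕ+) ∣ M'),
        ZMod.castHom (PNat.dvd_iff.mp h) (ZMod (M : ℕ+)) (x M') = x M) ∧
      ¬ ∃ n : ℤ, ∀ M : E, (n : ZMod (M : ℕ+)) = x M := by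
  refine ⟨fun M => (ESystem.twoAdicOne (M : ℕ+) : ZMod (M : ℕ+)), fun M M' h => ?_, ?_⟩
  · rw [map_intCast, ZMod.intCast_eq_intCast_iff_dvd_sub, ← dvd_neg, neg_sub]
    exact_mod_cast ESystem.twoAdicOne_compatible M M' h
  · rintro ⟨n, hn⟩
    obtain ⟨M, hME, hnot⟩ := ESystem.twoAdicOne_not_integral (E := E) hcof n
    exact hnot ((ZMod.intCast_eq_intCast_iff_dvd_sub _ _ _).mp (hn ⟨M, hME⟩))

/-! ## Corollary 2.16 (profinite non-discreteness of bi-theta environments) -/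

/-- The conjugation action of `x ∈ Π^tp_X` on `μ_M`-valued cocycles of `Π^tp_Ÿ` (the action of
`Gal(Y/X) ≅ l·ℤ` on classes): `(x·η)(g) = χ(aug x)(η(x⁻¹ g x))`. [cite: MochizukiEtTh2009, Cor 2.16 p.54] -/
def conjCocycle (M : E) (x : T.PiX) (η : T.PiYdd → T.mu M) : T.PiYdd → T.mu M :=
  fun g => T.chi M (T.aug x) (η ⟨x⁻¹ * g * x, by
    simpa [mul_assoc] using T.PiYdd_normal.conj_mem _ g.2 x⁻¹⟩)

/-- **Corollary 2.16** (Profinite Non-discreteness of Bi-theta Environments): for a member `η̈^Θ`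
(compatible family `η`) with its natural system of model bi-theta environments `β = red`, and any
`j_∞ ∈ l·Ẑ` (compatible residues `j_M`), there is a projective system `γ_{M',M} = α ∘ β ∘ α'`,
`α ∈ Aut(B_M)`, `α' ∈ Aut(B_{M'})` [(a)], whose level-`M` difference cocycle transported to `Π^tp_Ÿ`
is the conjugate of `η_M` by an element of `Π^tp_X` mapping to `k_M ∈ ℤ ≅ Gal(Y/X)` (`galYX`; print's
`l·ℤ`, generator `↔ l`), `k_M ≡ j_M (mod M)` ["the classes … converge to the `j_∞`-conjugate of
`η̈^Θ|_Ÿ`", (b)]. [cite: MochizukiEtTh2009, Cor 2.16 p.53] -/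
def Cor216 : Prop :=
  ∀ (η : ∀ M : E, T.PiYdd → T.mu M) (hη : ∀ M, η M ∈ T.thetaCocycles M)
    (_ : ∀ (M M' : E) (h : (M : ℕ+) ∣ M'), T.red M M' h ∘ η M' = η M)
    (j : ∀ M : E, ZMod (M : ℕ+))
    (_ : ∀ (M M' : E) (h : (M : ℕ+) ∣ M'),
      ZMod.castHom (PNat.dvd_iff.mp h) (ZMod (M : ℕ+)) (j M') = j M),
    ∃ γ : ∀ M M' : E, ((M : ℕ+) ∣ M') → ((T.level M').env →* (T.level M).env),
      -- (a) each `γ_{M',M}` is `α ∘ β_{M',M} ∘ α'` with `α ∈ Aut(B_M)`, `α' ∈ Aut(B_{M'})`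
      (∀ M M' h, ∃ (α : ((T.level M).modelBi (hη M)).Iso ((T.level M).modelBi (hη M)))
          (α' : ((T.level M').modelBi (hη M')).Iso ((T.level M').modelBi (hη M'))),
          ∀ x, γ M M' h x = α.e (T.redEnv M M' h (α'.e x))) ∧
      -- the `γ` form a projective system
      (∀ (M : E) (h : (M : ℕ+) ∣ M) x, γ M M h x = x) ∧
      (∀ (M M' M'' : E) (h : (M : ℕ+) ∣ M') (h' : (M' : ℕ+) ∣ M'') x,
          γ M M'' (h.trans h') x = γ M M' h (γ M' M'' h' x)) ∧
      -- (b) the transported difference cocycles are the `k_M`-conjugates of `η_M`, `k_M → j_∞`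
      ∃ (k : E → ℤ) (x : E → T.PiX),
        (∀ M : E, ((k M : ℤ) : ZMod (M : ℕ+)) = j M) ∧
        (∀ M, T.galYX (QuotientGroup.mk (x M)) = Multiplicative.ofAdd (k M)) ∧
        ∀ (M : E) (h1 : ((⟨1, T.one_mem⟩ : E) : ℕ+) ∣ (M : ℕ+)),
          ∃ (ψ : T.PiYdd ≃* T.PiYdd) (c : T.mu M),
            (∀ g, γ ⟨1, T.one_mem⟩ M h1 ((T.level M).sTheta (hη M) g) =
              (T.level ⟨1, T.one_mem⟩).sAlg (ψ g)) ∧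
            ∀ g, η M (ψ.symm g) = T.conjCocycle M (x M) (η M) g *
              CycEnvelope.coboundary (T.aug.comp T.PiYdd.subtype) (T.chi M) c g

/-! ## Corollary 2.19 (iii) (constant multiple rigidity), tower form -/

/-- Pull-back of `μ_M`-valued cocycles of `Π^tp_Ÿ` along `γ ∈ Aut(Π^tp_X)` with the coefficient
automorphism `γ̄_M` INDUCED by `γ` on `(l·Δ_Θ) ⊗ ℤ/M ≅ μ_M` (through `thetaMod`, Cor 2.18 (i)):
`(γ·η)(g) = γ̄_M⁻¹(η(γ g))`. [cite: MochizukiEtTh2009, Cor 2.19(iii) p.65] -/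
def pullbackCocycle (M : E) (γ : T.PiX ≃ₜ* T.PiX) (hγ : T.PiYdd.map γ.toMulEquiv.toMonoidHom = T.PiYdd)
    (γμ : T.mu M ≃* T.mu M) (η : T.PiYdd → T.mu M) : T.PiYdd → T.mu M :=
  fun g => γμ.symm (η ⟨γ g, by
    have : γ g ∈ T.PiYdd.map γ.toMulEquiv.toMonoidHom := ⟨g, g.2, rfl⟩
    rwa [hγ] at this⟩)

/-- **Corollary 2.19 (iii)** (first half, tower form), its FUNCTORIALITY content: the collections of
theta cocycle classes "may be constructed via a functorial group-theoretic algorithm; moreover an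
arbitrary automorphism of `Π•_X` preserves this collection of classes … [up to] some multiple of the
collection by an `l`-th root of unity" — typed WITHOUT the `l`-torsion clause: for every automorphism
`γ` of `Π^tp_X` with the coefficient automorphisms `γ̄_M` it INDUCES through `thetaMod`, the pulled-back
collections differ from the original ones by a COMPATIBLE family of CONTINUOUS `G_K`-inflated cocycles
(a `(K^×)^∧`-multiple; true for every associated orbit, p.47 "replacing `η̈^{Θ,l·ℤ×μ₂}` by an
`O_K^×`-multiple corresponds to replacing `s^Θ_Ÿ` by an `O_K^×`-conjugate", p.59). The RIGIDITY clause
"[the multiple is] an `l`-th root of unity" holds only under the printed hypothesis "`η̈^{Θ,l·ℤ×μ₂}` of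
standard type" (Def 1.9 (ii)), a CONCRETE condition on the values at the decomposition groups `D_τ`,
which are not tower data: it is typed where that data lives — `ThetaCovers.ThetaOrbitData.Cor28_i`
(`ThetaRootOrbits.lean`, Cor 2.8 (i), from which print derives it) — and is NOT asserted here for arbitrary
(possibly non-standard, `u · standard`) collections, for which it is false (audits abc-iut-L6-t23 /
review of p406836). [cite: MochizukiEtTh2009, Cor 2.19(iii) p.65] -/
def Cor219_iii : Prop :=
  ∀ (γ : T.PiX ≃ₜ* T.PiX) (hγ : T.PiYdd.map γ.toMulEquiv.toMonoidHom = T.PiYdd)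
    (γμ : ∀ M : E, T.mu M ≃* T.mu M)
    (_ : ∀ (M : E) (g : T.lDeltaTheta) (hg : γ g ∈ T.lDeltaTheta),
      T.thetaMod M ⟨γ g, hg⟩ = γμ M (T.thetaMod M g)),
    ∃ c : ∀ M : E, T.G → T.mu M,
      (∀ M, CycEnvelope.IsEnvCocycle (MonoidHom.id T.G) (T.chi M) (c M)) ∧
      (∀ M, IsLocallyConstant (c M ∘ T.aug)) ∧
      (∀ (M M' : E) (h : (M : ℕ+) ∣ M'), T.red M M' h ∘ c M' = c M) ∧
      ∀ M, T.pullbackCocycle M γ hγ (γμ M) '' T.thetaCocycles M =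
        (fun η => η * (c M ∘ T.aug ∘ T.PiYdd.subtype)) '' T.thetaCocycles M

/-! ### Corollary 2.19 (iii), second half (the induced projective system of BI-theta environments is
isomorphic to a natural one): typed in `ThetaBiSystems.lean` for the NATURAL mono-theta system (to which
(ii) reduces the general case), with the twisted algebraic sections — per the audits of abc-iut-L2-d1 /
L6-t23 (the earlier draft over an arbitrary system with `η' ∈ thetaCocycles` was refutable). -/

end ThetaEnvTower

end Literature.AnabelianGeometry.EtaleTheta
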